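/-
Copyright (c) 2026. All rights reserved.
Released under Apache 2.0 license as described in the file LICENSE.
-/
import Literature.Probability.FitznerVanDerHofstad2017.NoblePercLettersTransport
import HarnessLib

/-!
# Fitzner–van der Hofstad (2017), §4.2 / §6.2 — transporting a group of witnessed lines on `ℙ_p^{⊗k}` to a letter
(any number `k` of independent configurations)

[FvdH17] = R. Fitzner, R. van der Hofstad, *Mean-field behavior for nearest-neighbor percolation in `d > 10`*,
Electron. J. Probab. **22** (2017), no. 43, arXiv:1506.07977v2.

§4.2 Def. 4.1 (v2 p. 35 = EJP p. 33): the repulsive letters `𝓑, 𝓣, 𝓢, 𝓟` of (4.16)–(4.17) are MAXIMA over the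
assignments of the lines of a chain to i.i.d. configurations `ω₁, ω₂, ω₃, …`, the first line on the first
configuration.  §4.4 (4.65) and §6.2 (v2 pp. 43, 65–67): for `N ≥ 2` the bounding event of `Ξ^{(N)}` lives on
`N + 1` independent configurations (`ℙ^{(N)}`, "the events `F_0, …, F_N` occur on different percolation
configurations"), and the block bound (6.49)/(6.51) is obtained group by group, each group of lines living on two
ADJACENT levels `{i, i+1} ⊂ {0, …, N}` (the middle blocks `B^{κ,a,b}` of (5.4) mix level `i`'s exit line with level
`i+1`'s lines; cf. `NobleBoundsNClasses.le_recP_chain_of_pointwise`, whose measure is `piPerc d p (n+2)`).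

The dictionary `NoblePercLettersTransport` (§C–D there) is stated for TWO configurations (`piPerc d p 2`,
assignments `c : Fin m → Fin 2`), which is all the `N = 1` class files of §6.1 need.  This module supplies the same
dictionary for ANY number `k` of configurations and ANY assignment, which is what every `N ≥ 2` class estimate
(grouped BK on `piPerc d p (n+2)`, `LabelledDisjointOccurrenceGrouped.pi_genDisjOccGrouped_le_prod`) consumes:

* A. (generic: any probability measure `μ` on configurations, any events) relabelling the configurations of
  `⊛_i (A_i)_{c_i}` along an arbitrary INJECTION `f : Fin k → Fin k'` preserves the measure:
  `μ^{⊗k'}(⊛_i (A_i)_{f(c_i)}) = μ^{⊗k}(⊛_i (A_i)_{c_i})` (`pi_genDisjOcc_comp_of_injective`; the module docstring of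
  `LabelledDisjointOccurrenceRelabel` — "an arbitrary injective relabelling `Fin k ↪ Fin k'` is a permutation followed
  by the initial-segment inclusion `Fin.castLE`" — made a theorem, proved directly as a marginal);
* B. the TWO-LEVEL GROUP REDUCTION: a group whose lines sit on two configurations `i ≠ j` of `k` has the
  `ℙ_p^{⊗k}`-probability of the same group read on `ℙ_p^{⊗2}` (`piPerc_genDisjOcc_pair_eq`,
  `piPerc_genDisjOcc_eq_two_of_comp`; one level: `piPerc_genDisjOcc_eq_one_of_const`) — so every two-configuration
  letter lemma of the tree (`NoblePercLettersTransport`, the `N = 1` start / middle / end rows of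
  `NobleBoundsN1ClassTools`, `NobleBoundsN1Cls22` §D, `NobleBoundsN1IotaStart`) applies BY NAME to a group of an
  `(n+2)`-level chain;
* C. the maximum-over-assignments semantics in full: **`piPerc_genDisjOcc_le_repLetter_any`** —
  `ℙ_p^{⊗k}(⊛_i (A_i)_{c_i}) ≤ repLetter A` for EVERY `k` and EVERY `c : Fin (m+1) → Fin k` (factor `c` through its
  range, A., pad by `pi_genDisjOcc_castLE`, put the first line on the first configuration by `pi_genDisjOcc_perm`);
* D. the chain forms at any `k` with no side condition on the assignment: `… ≤ 𝓑 / 𝓣 / 𝓢 / 𝓟` (the pentagon `𝓟` is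
  new also at `k = 2`; it is the letter of the `B^{(2)}` rows of App. B, v2 p. 76), the one-line marginal `≤ τ`,
  the same-configuration pair `≤ 𝓓` and the different-configuration pair `≤ τ τ`.

Pure measure theory over the `Letters.perc` instance; every `d`, every `k`; nothing is cited as a fact and no
percolation estimate beyond Def. 4.1's bookkeeping is proved here.
-/

noncomputable section

namespace Literature.Probability.FitznerVanDerHofstad2017

open _root_.MeasureTheory Literature.Probability.Percolation
open scoped BigOperators ENNReal

/-! ### A. Relabelling the configurations along an injection (generic) -/

section Injective

variable {V : Type*} {k k' : ℕ} {ι : Type*}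

/-- **Marginal of `μ^{⊗k'}` along an injective relabelling of coordinates**: for `f : Fin k → Fin k'` injective and
EVERY set `S` of `k`-tuples, `μ^{⊗k'}((· ∘ f)⁻¹ S) = μ^{⊗k}(S)` (the coordinates outside the range of `f` integrate
out; the coordinates in the range are relabelled by `f`).  No measurability of `S` is needed (measurable
EQUIVALENCES `piEquivPiSubtypeProd`, `piCongrLeft` and a product rectangle). [folklore] -/
theorem pi_preimage_comp_of_injective (X : Type*) [MeasurableSpace X] (μ : Measure X) [IsProbabilityMeasure μ]
    {f : Fin k → Fin k'} (hf : Function.Injective f) (S : Set (Fin k → X)) :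
    Measure.pi (fun _ : Fin k' => μ) ((fun ω : Fin k' → X => ω ∘ f) ⁻¹' S) =
      Measure.pi (fun _ : Fin k => μ) S := by
  classical
  -- `p` is `· ∈ Set.range f` written out, so that the only `Fintype {i // p i}` instance in sight is `Subtype.fintype`
  set p : Fin k' → Prop := fun i => ∃ j, f j = i with hp
  have e1 := MeasureTheory.measurePreserving_piEquivPiSubtypeProd (fun _ : Fin k' => μ) p
  let eR : {i : Fin k' // p i} ≃ Fin k := (Equiv.ofInjective f hf).symm
  have e2 := MeasureTheory.measurePreserving_piCongrLeft (fun _ : Fin k => μ) eR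
  set Ψ : ({i : Fin k' // p i} → X) → (Fin k → X) :=
    ⇑(MeasurableEquiv.piCongrLeft (fun _ : Fin k => X) eR) with hΨ
  have hΨapply : ∀ (ω : {i : Fin k' // p i} → X) (j : Fin k), Ψ ω j = ω ⟨f j, ⟨j, rfl⟩⟩ := by
    intro ω j
    rw [hΨ, coe_piCongrLeft_const]
    show ω (eR.symm j) = _
    simp only [eR]
    rfl
  have hset : ((fun ω : Fin k' → X => ω ∘ f) ⁻¹' S) =
      ⇑(MeasurableEquiv.piEquivPiSubtypeProd (fun _ : Fin k' => X) p) ⁻¹' ((Ψ ⁻¹' S) ×ˢ Set.univ) := by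
    ext ω
    simp only [Set.mem_preimage, Set.mem_prod, Set.mem_univ, and_true]
    have hfun : Ψ ((MeasurableEquiv.piEquivPiSubtypeProd (fun _ : Fin k' => X) p) ω).1 = ω ∘ f := by
      funext j
      rw [hΨapply]
      rfl
    rw [hfun]
  rw [hset, e1.measure_preimage_equiv, Measure.prod_prod, measure_univ, mul_one]
  exact e2.measure_preimage_equiv S

/-- **Injective relabelling of the configurations preserves the probability of `⊛_i (A_i)_{c_i}`**:
`μ^{⊗k'}(⊛_i (A_i)_{f(c_i)}) = μ^{⊗k}(⊛_i (A_i)_{c_i})` for every injection `f : Fin k → Fin k'` — exchangeability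
and marginals in one statement ("`ω₁, ω₂, ω₃` are three i.i.d. percolation configurations").
[cite: FitznerVanDerHofstad2017, §4.2 Def. 4.1 and (4.16)–(4.17) (arXiv:1506.07977v2 pp. 35–36)] -/
theorem pi_genDisjOcc_comp_of_injective (μ : Measure (BondConfig V)) [IsProbabilityMeasure μ]
    {f : Fin k → Fin k'} (hf : Function.Injective f) (A : ι → Set (BondConfig V)) (c : ι → Fin k) :
    Measure.pi (fun _ : Fin k' => μ) (genDisjOcc A (f ∘ c)) = Measure.pi (fun _ : Fin k => μ) (genDisjOcc A c) := by
  rw [genDisjOcc_comp_eq_preimage]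
  exact pi_preimage_comp_of_injective (BondConfig V) μ hf _

end Injective

/-! ### B. Percolation: groups living on one or two of `k` configurations -/

namespace NobleBlocks

open Literature.Probability.LatticeModels Literature.Probability.FitznerVanDerHofstad2017.NobleBlocks.LenIdx

variable {d : ℕ} {ι : Type*} {k : ℕ}

section Reduce

variable (p : unitInterval)

/-- `ℙ_p^{⊗k'}(⊛_i (A_i)_{f(c_i)}) = ℙ_p^{⊗k}(⊛_i (A_i)_{c_i})` for an injection `f : Fin k → Fin k'`.
[cite: FitznerVanDerHofstad2017, §4.2 Def. 4.1 (arXiv:1506.07977v2 p. 35)] -/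
theorem piPerc_genDisjOcc_comp_of_injective {k' : ℕ} {f : Fin k → Fin k'} (hf : Function.Injective f)
    (A : ι → Set (BondConfig (Site d))) (c : ι → Fin k) :
    piPerc d p k' (genDisjOcc A (f ∘ c)) = piPerc d p k (genDisjOcc A c) := by
  unfold piPerc
  exact pi_genDisjOcc_comp_of_injective _ hf A c

/-- **Two-level group reduction.**  A group of lines assigned to two configurations `i ≠ j` out of `k` has the
probability of the same group on `ℙ_p^{⊗2}` (configuration `i ↦ 0`, `j ↦ 1`):
`ℙ_p^{⊗k}(⊛_m (A_m)_{![i,j](c'_m)}) = ℙ_p^{⊗2}(⊛_m (A_m)_{c'_m})`.  This is how a middle block of the `N ≥ 2` chain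
(levels `i, i+1` of `N+1`) is read with the two-configuration letter lemmas of §6.1.
[cite: FitznerVanDerHofstad2017, §4.4 (4.65) and §6.2 (arXiv:1506.07977v2 pp. 43, 65–67)] -/
theorem piPerc_genDisjOcc_pair_eq {i j : Fin k} (hij : i ≠ j) (A : ι → Set (BondConfig (Site d)))
    (c' : ι → Fin 2) :
    piPerc d p k (genDisjOcc A (![i, j] ∘ c')) = piPerc d p 2 (genDisjOcc A c') := by
  -- `![i, j]` is injective for `i ≠ j` (inlined; the tree has this fact only in unrelated modules)
  have hf : Function.Injective (![i, j] : Fin 2 → Fin k) := by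
    intro a b h
    fin_cases a <;> fin_cases b
    · rfl
    · exact absurd h hij
    · exact absurd h.symm hij
    · rfl
  exact piPerc_genDisjOcc_comp_of_injective p hf A c'

/-- Two-level group reduction, factorisation form: if every label `c m` is `![i, j] (c' m)` with `i ≠ j`, then
`ℙ_p^{⊗k}(⊛_m (A_m)_{c_m}) = ℙ_p^{⊗2}(⊛_m (A_m)_{c'_m})`. [cite: FitznerVanDerHofstad2017, §6.2 (arXiv:1506.07977v2 pp. 65–67)] -/
theorem piPerc_genDisjOcc_eq_two_of_comp {i j : Fin k} (hij : i ≠ j) (A : ι → Set (BondConfig (Site d)))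
    {c : ι → Fin k} (c' : ι → Fin 2) (hc : ∀ m, c m = ![i, j] (c' m)) :
    piPerc d p k (genDisjOcc A c) = piPerc d p 2 (genDisjOcc A c') := by
  have h : c = ![i, j] ∘ c' := funext hc
  rw [h]
  exact piPerc_genDisjOcc_pair_eq p hij A c'

/-- One-level group reduction: if every line of the group sits on the same configuration `i`, the probability is
that of the group on a single configuration `ℙ_p^{⊗1}` (all labels `0`).
[cite: FitznerVanDerHofstad2017, §4.2 Def. 4.1 ("the usual disjoint occurrence") (arXiv:1506.07977v2 p. 35)] -/
theorem piPerc_genDisjOcc_eq_one_of_const {i : Fin k} (A : ι → Set (BondConfig (Site d))) {c : ι → Fin k}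
    (hc : ∀ m, c m = i) :
    piPerc d p k (genDisjOcc A c) = piPerc d p 1 (genDisjOcc A (fun _ => (0 : Fin 1))) := by
  have hf : Function.Injective (fun _ : Fin 1 => i) := fun a b _ => Subsingleton.elim a b
  have h : c = (fun _ : Fin 1 => i) ∘ (fun _ : ι => (0 : Fin 1)) := funext fun m => hc m
  rw [h]
  exact piPerc_genDisjOcc_comp_of_injective p hf A _

/-- Under the two-level reduction, label (in)equalities transfer: `c a = c b ↔ c' a = c' b`. [folklore] -/
theorem label_eq_iff_of_comp {i j : Fin k} (hij : i ≠ j) {c : ι → Fin k} {c' : ι → Fin 2}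
    (hc : ∀ m, c m = ![i, j] (c' m)) (a b : ι) : c a = c b ↔ c' a = c' b := by
  rw [hc a, hc b]
  constructor
  · intro h
    have ha : ∀ x : Fin 2, x = 0 ∨ x = 1 := by decide
    rcases ha (c' a) with h0 | h0 <;> rcases ha (c' b) with h1 | h1 <;> rw [h0, h1] at h ⊢ <;>
      first | rfl | exact absurd h hij | exact absurd h.symm hij
  · intro h
    rw [h]

end Reduce

/-! ### C. Any number of configurations into a letter -/

section AnyLevels

variable (p : unitInterval)

/-- **`ℙ_p^{⊗k}(⊛_i (A_i)_{c_i}) ≤ repLetter A` for EVERY number `k` of configurations and EVERY assignment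
`c : Fin (m+1) → Fin k`**: factor `c = f ∘ c₁` through its range (`f` injective, `c₁` into `Fin s`,
`s = #range c ≤ m+1`), relabel (`pi_genDisjOcc_comp_of_injective`), pad the unused configurations
(`pi_genDisjOcc_castLE`), and put the first line on the first configuration (`pi_genDisjOcc_perm` with a
transposition); the result is a member of the maximum (4.16)–(4.17).
[cite: FitznerVanDerHofstad2017, §4.2 Def. 4.1, (4.16)–(4.17) (arXiv:1506.07977v2 pp. 35–36)] -/
theorem piPerc_genDisjOcc_le_repLetter_any (k : ℕ) {m : ℕ} (A : Fin (m + 1) → Set (BondConfig (Site d)))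
    (c : Fin (m + 1) → Fin k) : piPerc d p k (genDisjOcc A c) ≤ repLetter d p A := by
  classical
  -- factor `c` through its range
  set s : ℕ := Fintype.card (Set.range c) with hs_def
  let e : Set.range c ≃ Fin s := Fintype.equivFin (Set.range c)
  let c₁ : Fin (m + 1) → Fin s := fun i => e ⟨c i, Set.mem_range_self i⟩
  let f : Fin s → Fin k := fun j => (e.symm j).1
  have hf : Function.Injective f := fun a b h => e.symm.injective (Subtype.ext h)
  have hfc : f ∘ c₁ = c := by
    funext i
    simp [f, c₁]
  have hs : s ≤ m + 1 := by
    have h := Fintype.card_range_le c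
    rw [← hs_def, Fintype.card_fin] at h
    exact h
  -- relabel, pad, swap
  have h1 : piPerc d p k (genDisjOcc A c) = piPerc d p s (genDisjOcc A c₁) := by
    rw [← hfc]
    exact piPerc_genDisjOcc_comp_of_injective p hf A c₁
  have h2 : piPerc d p s (genDisjOcc A c₁) = piPerc d p (m + 1) (genDisjOcc A (Fin.castLE hs ∘ c₁)) := by
    unfold piPerc
    exact (pi_genDisjOcc_castLE (bondPercolation (zdGraph d) p) hs A c₁).symm
  set c₂ : Fin (m + 1) → Fin (m + 1) := Fin.castLE hs ∘ c₁ with hc₂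
  set σ : Equiv.Perm (Fin (m + 1)) := Equiv.swap (0 : Fin (m + 1)) (c₂ 0) with hσ
  have h3 : piPerc d p (m + 1) (genDisjOcc A c₂) = piPerc d p (m + 1) (genDisjOcc A (σ ∘ c₂)) := by
    unfold piPerc
    exact (pi_genDisjOcc_perm (bondPercolation (zdGraph d) p) σ A c₂).symm
  have hσ0 : (σ ∘ c₂) 0 = 0 := by
    simp [hσ, Equiv.swap_apply_right]
  rw [h1, h2, h3]
  exact piPerc_genDisjOcc_le_repLetter p A hσ0

/-- **Chain of two witnessed lines on ANY configurations ≤ the repulsive bubble**: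
`ℙ_p^{⊗k}(⊛ {y₀ ←j₁→ y₁}_{c₀} {y₁ ←j₂→ y₂}_{c₁}) ≤ 𝓑_{j₁,j₂}(y₁−y₀, y₂−y₀)`.
[cite: FitznerVanDerHofstad2017, §4.2 (4.16) (arXiv:1506.07977v2 p. 36); §6.2 (pp. 65–67)] -/
theorem piPerc_genDisjOcc_le_B (j₁ j₂ : LenIdx) (y₀ y₁ y₂ : Site d) (c : Fin 2 → Fin k) :
    piPerc d p k (genDisjOcc ![event j₁ y₀ y₁, event j₂ y₁ y₂] c) ≤
      (Letters.perc d p).B j₁ j₂ (y₁ - y₀) (y₂ - y₀) := by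
  have h := piPerc_genDisjOcc_event_shift p y₀ ![j₁, j₂] ![0, y₁ - y₀] ![y₁ - y₀, y₂ - y₀] c
  have e1 : (fun i => event (![j₁, j₂] i) ((![0, y₁ - y₀] : Fin 2 → Site d) i + y₀)
      ((![y₁ - y₀, y₂ - y₀] : Fin 2 → Site d) i + y₀)) = ![event j₁ y₀ y₁, event j₂ y₁ y₂] := by
    funext i; fin_cases i <;> simp
  have e2 : (fun i => event (![j₁, j₂] i) ((![0, y₁ - y₀] : Fin 2 → Site d) i)
      ((![y₁ - y₀, y₂ - y₀] : Fin 2 → Site d) i)) = lineEvents₂ j₁ j₂ (y₁ - y₀) (y₂ - y₀) := by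
    funext i; fin_cases i <;> rfl
  rw [e1, e2] at h
  rw [h, perc_B]
  exact piPerc_genDisjOcc_le_repLetter_any p k _ c

/-- **Chain of three witnessed lines on ANY configurations ≤ the repulsive triangle**:
`ℙ_p^{⊗k}(⊛_i {yᵢ ←jᵢ₊₁→ yᵢ₊₁}_{cᵢ}, i < 3) ≤ 𝓣_{j₁,j₂,j₃}(y₁−y₀, y₂−y₀, y₃−y₀)`.
[cite: FitznerVanDerHofstad2017, §4.2 (4.17) (arXiv:1506.07977v2 p. 36); §6.2 (pp. 65–67)] -/
theorem piPerc_genDisjOcc_le_T (j₁ j₂ j₃ : LenIdx) (y₀ y₁ y₂ y₃ : Site d) (c : Fin 3 → Fin k) :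
    piPerc d p k (genDisjOcc ![event j₁ y₀ y₁, event j₂ y₁ y₂, event j₃ y₂ y₃] c) ≤
      (Letters.perc d p).T j₁ j₂ j₃ (y₁ - y₀) (y₂ - y₀) (y₃ - y₀) := by
  have h := piPerc_genDisjOcc_event_shift p y₀ ![j₁, j₂, j₃] ![0, y₁ - y₀, y₂ - y₀]
    ![y₁ - y₀, y₂ - y₀, y₃ - y₀] c
  have e1 : (fun i => event (![j₁, j₂, j₃] i) ((![0, y₁ - y₀, y₂ - y₀] : Fin 3 → Site d) i + y₀)
      ((![y₁ - y₀, y₂ - y₀, y₃ - y₀] : Fin 3 → Site d) i + y₀)) =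
      ![event j₁ y₀ y₁, event j₂ y₁ y₂, event j₃ y₂ y₃] := by
    funext i; fin_cases i <;> simp
  have e2 : (fun i => event (![j₁, j₂, j₃] i) ((![0, y₁ - y₀, y₂ - y₀] : Fin 3 → Site d) i)
      ((![y₁ - y₀, y₂ - y₀, y₃ - y₀] : Fin 3 → Site d) i)) = lineEvents₃ j₁ j₂ j₃ (y₁ - y₀) (y₂ - y₀) (y₃ - y₀) := by
    funext i; fin_cases i <;> rfl
  rw [e1, e2] at h
  rw [h, perc_T]
  exact piPerc_genDisjOcc_le_repLetter_any p k _ c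

/-- **Chain of four witnessed lines on ANY configurations ≤ the repulsive square**:
`ℙ_p^{⊗k}(⊛_i {yᵢ ←jᵢ₊₁→ yᵢ₊₁}_{cᵢ}, i < 4) ≤ 𝓢_{j₁,…,j₄}(y₁−y₀, …, y₄−y₀)`.
[cite: FitznerVanDerHofstad2017, §4.2 after (4.17) (arXiv:1506.07977v2 p. 36); §6.2 (pp. 65–67)] -/
theorem piPerc_genDisjOcc_le_S (j₁ j₂ j₃ j₄ : LenIdx) (y₀ y₁ y₂ y₃ y₄ : Site d) (c : Fin 4 → Fin k) :
    piPerc d p k (genDisjOcc ![event j₁ y₀ y₁, event j₂ y₁ y₂, event j₃ y₂ y₃, event j₄ y₃ y₄] c) ≤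
      (Letters.perc d p).S j₁ j₂ j₃ j₄ (y₁ - y₀) (y₂ - y₀) (y₃ - y₀) (y₄ - y₀) := by
  have h := piPerc_genDisjOcc_event_shift p y₀ ![j₁, j₂, j₃, j₄] ![0, y₁ - y₀, y₂ - y₀, y₃ - y₀]
    ![y₁ - y₀, y₂ - y₀, y₃ - y₀, y₄ - y₀] c
  have e1 : (fun i => event (![j₁, j₂, j₃, j₄] i) ((![0, y₁ - y₀, y₂ - y₀, y₃ - y₀] : Fin 4 → Site d) i + y₀)
      ((![y₁ - y₀, y₂ - y₀, y₃ - y₀, y₄ - y₀] : Fin 4 → Site d) i + y₀)) =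
      ![event j₁ y₀ y₁, event j₂ y₁ y₂, event j₃ y₂ y₃, event j₄ y₃ y₄] := by
    funext i; fin_cases i <;> simp
  have e2 : (fun i => event (![j₁, j₂, j₃, j₄] i) ((![0, y₁ - y₀, y₂ - y₀, y₃ - y₀] : Fin 4 → Site d) i)
      ((![y₁ - y₀, y₂ - y₀, y₃ - y₀, y₄ - y₀] : Fin 4 → Site d) i)) =
      lineEvents₄ j₁ j₂ j₃ j₄ (y₁ - y₀) (y₂ - y₀) (y₃ - y₀) (y₄ - y₀) := by
    funext i; fin_cases i <;> rfl
  rw [e1, e2] at h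
  rw [h, perc_S]
  exact piPerc_genDisjOcc_le_repLetter_any p k _ c

/-- **Chain of five witnessed lines on ANY configurations ≤ the repulsive pentagon**:
`ℙ_p^{⊗k}(⊛_i {yᵢ ←jᵢ₊₁→ yᵢ₊₁}_{cᵢ}, i < 5) ≤ 𝓟_{j₁,…,j₅}(y₁−y₀, …, y₅−y₀)` (the letter of the `B^{(2),ι,a,b}`
rows of App. B). [cite: FitznerVanDerHofstad2017, §4.2 after (4.17) (arXiv:1506.07977v2 p. 36); App. B Table "B^{(2),ι,a,b}" (p. 76)] -/
theorem piPerc_genDisjOcc_le_P (j₁ j₂ j₃ j₄ j₅ : LenIdx) (y₀ y₁ y₂ y₃ y₄ y₅ : Site d) (c : Fin 5 → Fin k) :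
    piPerc d p k (genDisjOcc
        ![event j₁ y₀ y₁, event j₂ y₁ y₂, event j₃ y₂ y₃, event j₄ y₃ y₄, event j₅ y₄ y₅] c) ≤
      (Letters.perc d p).P j₁ j₂ j₃ j₄ j₅ (y₁ - y₀) (y₂ - y₀) (y₃ - y₀) (y₄ - y₀) (y₅ - y₀) := by
  have h := piPerc_genDisjOcc_event_shift p y₀ ![j₁, j₂, j₃, j₄, j₅]
    ![0, y₁ - y₀, y₂ - y₀, y₃ - y₀, y₄ - y₀] ![y₁ - y₀, y₂ - y₀, y₃ - y₀, y₄ - y₀, y₅ - y₀] c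
  have e1 : (fun i => event (![j₁, j₂, j₃, j₄, j₅] i)
      ((![0, y₁ - y₀, y₂ - y₀, y₃ - y₀, y₄ - y₀] : Fin 5 → Site d) i + y₀)
      ((![y₁ - y₀, y₂ - y₀, y₃ - y₀, y₄ - y₀, y₅ - y₀] : Fin 5 → Site d) i + y₀)) =
      ![event j₁ y₀ y₁, event j₂ y₁ y₂, event j₃ y₂ y₃, event j₄ y₃ y₄, event j₅ y₄ y₅] := by
    funext i; fin_cases i <;> simp
  have e2 : (fun i => event (![j₁, j₂, j₃, j₄, j₅] i)
      ((![0, y₁ - y₀, y₂ - y₀, y₃ - y₀, y₄ - y₀] : Fin 5 → Site d) i)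
      ((![y₁ - y₀, y₂ - y₀, y₃ - y₀, y₄ - y₀, y₅ - y₀] : Fin 5 → Site d) i)) =
      lineEvents₅ j₁ j₂ j₃ j₄ j₅ (y₁ - y₀) (y₂ - y₀) (y₃ - y₀) (y₄ - y₀) (y₅ - y₀) := by
    funext i; fin_cases i <;> rfl
  rw [e1, e2] at h
  rw [h, perc_P]
  exact piPerc_genDisjOcc_le_repLetter_any p k _ c

/-! ### D. One-line and two-line groups on any configurations -/

/-- A group of ONE witnessed line on any of `k` configurations: `ℙ_p^{⊗k}(⊛ {y₀ ←j→ y₁}_{c₀}) ≤ τ_j(y₁ − y₀)`.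
[cite: FitznerVanDerHofstad2017, §4.2 (4.10) (arXiv:1506.07977v2 p. 35)] -/
theorem piPerc_genDisjOcc_one_le_tau (j : LenIdx) (y₀ y₁ : Site d) (c : Fin 1 → Fin k) :
    piPerc d p k (genDisjOcc ![event j y₀ y₁] c) ≤ (Letters.perc d p).tau j (y₁ - y₀) := by
  have hsub : genDisjOcc ![event j y₀ y₁] c ⊆ Function.eval (c 0) ⁻¹' (event j y₀ y₁ : Set (BondConfig (Site d))) := by
    rintro ω ⟨K, hKω, hKA, -⟩
    exact isUpperSet_event j y₀ y₁ (hKω 0) (hKA 0)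
  have hmp : MeasurePreserving (Function.eval (c 0)) (piPerc d p k) (bondPercolation (zdGraph d) p) := by
    unfold piPerc; exact measurePreserving_eval _ (c 0)
  calc piPerc d p k (genDisjOcc ![event j y₀ y₁] c)
      ≤ piPerc d p k (Function.eval (c 0) ⁻¹' (event j y₀ y₁ : Set (BondConfig (Site d)))) := measure_mono hsub
    _ = bondPercolation (zdGraph d) p (event j y₀ y₁) :=
        hmp.measure_preimage (measurableSet_event j y₀ y₁).nullMeasurableSet
    _ = (Letters.perc d p).tau j (y₁ - y₀) := measure_event_eq_perc_tau p j y₀ y₁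

/-- A group of TWO witnessed lines between the same points on the SAME one of `k` configurations:
`ℙ_p^{⊗k}(⊛ {y₀ ←j₁→ y₁}_{i} {y₀ ←j₂→ y₁}_{i}) ≤ 𝓓_{j₁,j₂}(y₁ − y₀)`.
[cite: FitznerVanDerHofstad2017, §4.2 (4.12) (arXiv:1506.07977v2 p. 35)] -/
theorem piPerc_genDisjOcc_two_le_D (j₁ j₂ : LenIdx) (y₀ y₁ : Site d) (c : Fin 2 → Fin k) (hc : c 0 = c 1) :
    piPerc d p k (genDisjOcc ![event j₁ y₀ y₁, event j₂ y₀ y₁] c) ≤ (Letters.perc d p).D j₁ j₂ (y₁ - y₀) := by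
  have hconst : ∀ m, c m = c 0 := by
    intro m; fin_cases m
    · rfl
    · exact hc.symm
  rw [piPerc_genDisjOcc_eq_one_of_const p _ hconst]
  have h' := pi_genDisjOcc_castLE (bondPercolation (zdGraph d) p) (show 1 ≤ 2 by omega)
    ![event j₁ y₀ y₁, event j₂ y₀ y₁] (fun _ : Fin 2 => (0 : Fin 1))
  unfold piPerc
  rw [← h']
  exact piPerc_two_genDisjOcc_two_le_D p j₁ j₂ y₀ y₁ _ rfl

/-- A group of TWO witnessed lines on DIFFERENT configurations (any two of `k`):
`ℙ_p^{⊗k}(⊛ {a ←j₁→ b}_{i} {a' ←j₂→ b'}_{j}) ≤ τ_{j₁}(b − a) τ_{j₂}(b' − a')`, `i ≠ j` (independence of the levels).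
[cite: FitznerVanDerHofstad2017, §4.4 (4.65) (arXiv:1506.07977v2 p. 43)] -/
theorem piPerc_genDisjOcc_two_le_tau_mul (j₁ j₂ : LenIdx) (a b a' b' : Site d) (c : Fin 2 → Fin k)
    (hc : c 0 ≠ c 1) :
    piPerc d p k (genDisjOcc ![event j₁ a b, event j₂ a' b'] c) ≤
      (Letters.perc d p).tau j₁ (b - a) * (Letters.perc d p).tau j₂ (b' - a') := by
  have hcomp : ∀ m, c m = ![c 0, c 1] ((![0, 1] : Fin 2 → Fin 2) m) := by
    intro m; fin_cases m <;> rfl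
  rw [piPerc_genDisjOcc_eq_two_of_comp p hc _ ![0, 1] hcomp]
  exact piPerc_two_genDisjOcc_two_le_tau_mul p j₁ j₂ a b a' b' _ (by decide)

end AnyLevels

end NobleBlocks

end Literature.Probability.FitznerVanDerHofstad2017

end
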